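import Summits.CriticalPhenomena.PercolationContinuityZ3.Theorems.Transplant.Slab111HubXS01R1
import Summits.CriticalPhenomena.PercolationContinuityZ3.Theorems.Transplant.Slab111HubXS01R2
import Summits.CriticalPhenomena.PercolationContinuityZ3.Theorems.Transplant.Slab111HubXS01R3
import Summits.CriticalPhenomena.PercolationContinuityZ3.Theorems.Transplant.Slab111HubXLink
import HarnessLib

/-!
# The ZONE-FREE dispatcher of the `(111)`-films — all certificates of the shape `S01` and the node `xlinkage_S01` at its block types (`k ≥ 10`)

builds on p205010 (kernel theorem, internal audit signed; external expert review pending) — NOT used in this file.  Lane `prim-bschramm`, seat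
`prim-bschramm-p2` (gen 37; class C1b; memo `HOME/bschramm/P2-LATTICES.md` §135); helper file (`--supports stmt-CriticalPhenomena-4575 --as helper`).
**`xcerts_S01`** collects the kernel-checked row certificates (files `Slab111HubXS01P*`, `…R*`); **`xlinkage_S01`** =
«Slab111HubXLink».`linkage_of_certsX` for the shape at every block type of its family, for every thickness `k ≥ 10`.
[cite: DuminilCopinSidoraviciusTassion2016, §2.3 (proof of Fact 2: the three disjoint paths γ_u, γ_v, γ_w in B_R(z))]
-/

noncomputable section

namespace Summit.CriticalPhenomena.PercolationContinuityZ3.Theorems.Transplant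

open Literature.Probability.Percolation Literature.Probability.LatticeModels SimpleGraph

namespace Slab111

/-- **All row certificates of shape `S01`.** [folklore] -/
theorem xcerts_S01 : ∀ q₁ ∈ ecolsOf shapeS01, ∀ q₂ ∈ ecolsOf shapeS01, ∃ (pool : List ℕ) (Ns : List (List ℕ)), certRowOK shapeS01 10 q₁ q₂ pool Ns = true := by
  intro q₁ h₁
  have h₁' : q₁ ∈ ([(0, -1), (-1, 1), (-1, 0), (1, -1), (0, -2), (-2, 2), (-2, 0), (2, -2), (1, -2), (-1, -1), (-2, 1), (-3, 1), (-3, 2), (-2, -1), (-1, -2), (1, -3), (2, -3)] : List (ℤ × ℤ)) := h₁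
  simp only [List.mem_cons, List.not_mem_nil, or_false] at h₁'
  rcases h₁' with rfl | rfl | rfl | rfl | rfl | rfl | rfl | rfl | rfl | rfl | rfl | rfl | rfl | rfl | rfl | rfl | rfl
  · exact xrowsS01_1
  · exact xrowsS01_2
  · exact xrowsS01_3
  · exact xrowsS01_4
  · exact xrowsS01_5
  · exact xrowsS01_6
  · exact xrowsS01_7
  · exact xrowsS01_8
  · exact xrowsS01_9
  · exact xrowsS01_10
  · exact xrowsS01_11
  · exact xrowsS01_12
  · exact xrowsS01_13
  · exact xrowsS01_14
  · exact xrowsS01_15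
  · exact xrowsS01_16
  · exact xrowsS01_17

/-- **THE NODE AT THE BLOCK TYPES OF SHAPE `S01`** (`k ≥ 10`): shaped local linkage from the zone-free certificates. [cite: DuminilCopinSidoraviciusTassion2016, §2.3 (proof of Fact 2: the three disjoint paths γ_u, γ_v, γ_w in B_R(z))] -/
theorem xlinkage_S01 {k : ℕ} (hk : 10 ≤ k) (z : Site 2) {tR tD sD : ℕ} (htR : 3 ≤ tR) (htD : tR ≤ tD) (hsD : sD = 1) :
    ∃ W : Set (slab111 k), (∀ x ∈ W, (hexShadow k).sh x ∈ blkR 3 z tD sD) ∧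
      (∀ x, (hexShadow k).sh x ∈ hexBall z 1 → (hexShadow k).sh x ∈ blkR 3 z tD sD → x ∈ W) ∧
      ∀ (E₁ E₂ w' : slab111 k), (hexShadow k).Terminals 3 z tR tD 0 W E₁ E₂ w' →
        ∃ r₁ r₂ : VRouteData (film k) (W ∩ (hexShadow k).lift (blkR 3 z tR 0)) W E₁ E₂ w', r₁.y = r₂.b ∧ r₁.b = r₂.y :=
  linkage_of_certsX (kmin := 10) (by exact_mod_cast hk) (shapeS01_valid htR htD hsD) xcerts_S01 z

end Slab111

end Summit.CriticalPhenomena.PercolationContinuityZ3.Theorems.Transplant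

end
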